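import Literature.MathematicalPhysics.QuantumFieldTheory.Balaban1983to89.HaarDensityUnitaryExplicit
import Literature.LinearAlgebra.AdEigenvaluesTraceless

/-!
# `Balaban1983to89.HaarDensitySpecialUnitaryExplicit` — [Balaban1985UV3] p. 260 «σ(A′) is a density which can be
# calculated EXPLICITLY for all classical groups», THE CASE `G = SU(N)` (print's example group, Thm. 1 p. 257 /
# «for SU(2) we have σ(A) = 1/2π² (sin|A|/|A|)²»): `det jac_{𝔰𝔲(N)}(X) = det jac_{𝔲(N)}(X) = Π_{j,k} sinc((θ_j − θ_k)/2)`

statement-level skeleton of published theorems with citation tags; proofs where landed; nothing here is a claim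
about the Yang–Mills mass gap

Mega-formalization `lit-balaban` (HOME `run/shared/lean/pub/lit-balaban/`), unit `lit-balaban-p28` gen 11 (Phase-2
proof seat, free-target protocol G.5-34(d); TAKING 2026-08-22T08:47Z).  File F4 of the gen-11 target (F1 =
`Literature.LinearAlgebra.AdEigenvaluesTraceless`, F2 = `HaarDensityComplexification`, F3 =
`HaarDensityUnitaryExplicit`).  SKELETON rows served (SUPPORT cells only, no head change): B10.Eq21 / display E18
([Balaban1985UV3] (18)/(21) pp. 260–261, owner r07; closes r07's `B10Eq18SigmaSU2Haar` HONEST SCOPE (ii) «no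
exponential-chart Haar density for SU(N), N ≥ 3, exists in the tree» at the level of the EXPLICIT density), B10.Thm1
(the hypothesis «semi-simple compact Lie group G», print's example `SU(2)`), B13.Eq1.37 / Lem2 (owner r10),
B12.Eq2.10–2.12 (r09/r20).

CITATION HEADER.  [Balaban1985UV3] T. Bałaban, CMP **102** (1985) 255–275, p. 260 (held
`paper:balaban1985-cmp102-uv-stability-3d`, render `…-p006-x2.png`): *«σ(A′) is a density which can be calculated
explicitly for all classical groups. For example for SU(2) we have σ(A) = 1/2π² (sin|A|/|A|)², where |A| = Σ_{a=1}^{3}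
(A^a)² [sic], and an element A of the Lie algebra is represented as A = Σ σ_aA^a, σ_a are the three Pauli matrices»*.
[Helgason2000] Ch. I §1 **Thm. 1.14** (12) p. 96 — tree: `det jac`, `jac = B13HaarSigmaJacobian.jac` (r10).
[Rossmann2002] §1.2 **Lemma 8** (PDF p. 18) and §3.2 **(5)**, **Table 3.6** row `A_{n−1}` (PDF pp. 106–109): the
eigenvalues of `ad` on `𝔰𝔩(n, ℂ)` are the `λ_j − λ_k` — tree (this unit, F1):
`Literature.LinearAlgebra.AdEigenvalues.prod_map_roots_charpoly_restrict_ad`.  [Balaban1987RG1] CMP **109** §0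
p. 252 «𝐠ᶜ is the complexification of the real Lie algebra 𝐠», p. 259 («G = SU(2)») — tree (p24):
`B12LieComplexification.complexify_su_eq_sl` (`𝔰𝔲(N)ᶜ = 𝔰𝔩(N, ℂ)`).  [Sepanski2007] **Thm. 5.14** (PDF p. 152): the
eigenvalue evaluation `(1 − e^{−λ})/λ` of the Jacobian endomorphism.

WHAT IS PROVED (theorems only; 0 definitions, 0 named facts, 0 sorry; axioms standard).  `𝔰𝔲(N) =
Literature.Algebra.Lie.CompactKillingForm.su n` (traceless skew-Hermitian matrices), `jac_{𝔰𝔲(N)} =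
B13HaarSigmaJacobian.jac (hlie_lieSubalgebra (su n))` (the object of r10's `det_jac_su_neg`, `det_jac_su2`).
* §1 `𝔰𝔲(N)ᶜ = 𝔰𝔩(N,ℂ)` at the level of `ad`: `complexify_su_toSubmodule_eq` (the carrier is `ker tr`),
  `charpoly_adg_complexify_su_eq` (`charpoly(ad_{𝔰𝔲ᶜ} z) = charpoly(ad z|_{𝔰𝔩})`).
* §2 **`det_jac_su_eq_prod_roots`: `(det jac_{𝔰𝔲(N)}(X) : ℂ) = Π_{(λ,μ)} φ(λ − μ)`** over ordered pairs of
  characteristic roots of `X` (`N ≥ 1`; the missing zero of `ad|_{𝔰𝔩}` contributes `φ(0) = 1`), and hence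
  **`det_jac_su_eq_det_jac_unitaryLie`: `det jac_{𝔰𝔲(N)}(X) = det jac_{𝔲(N)}(X)`** for `X ∈ 𝔰𝔲(N)`.
* §3 **`det_jac_su_eq_prod_sinc_of_roots` / `det_jac_su_eq_prod_sinc`:
  `det jac_{𝔰𝔲(N)}(X) = Π_j Π_k sinc((θ_j − θ_k)/2)`**, `iθ_j` the characteristic roots of `X` (F3's closed form
  transported by §2); complex form `det_jac_su_eq_prod_phi_of_roots`; squared form `det_jac_su_eq_sq_prod_sinc_lt`
  (`Π_{j<k} (sin((θ_j − θ_k)/2)/((θ_j − θ_k)/2))²`).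
* §4 PRINT'S EXAMPLE `SU(2)`: `det_jac_su_two_eq_sinc_sq` — if the characteristic roots of `X ∈ 𝔰𝔲(2)` are `±ir` then
  `det jac_{𝔰𝔲(2)}(X) = sinc(r)²`; in print's Pauli coordinates `X(A) = iΣσ_aA^a` (r07's `su2Coord`):
  `charpoly_su2Coord` (`T² + |A|²`), `roots_charpoly_su2Coord` (`±i|A|`), and hypothesis-free
  **`det_jac_su2Coord`: `det jac_{𝔰𝔲(2)}(X(A)) = sinc(|A|)² = (sin|A|/|A|)²`** — print's `σ(A)/σ₀`, the value of r10's
  `B13HaarSigmaJacobian.det_jac_su2` / r07's `B10Eq18SigmaSU2.sigmaRel_su2`, recovered as the case `N = 2`.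

HONEST SCOPE.  (i) `SU(N)` and (via F3) `U(N)` only; `SO(N)`/`Sp(N)` (types B, C, D) are not treated.  (ii) Statements
concern `det jac = σ/σ₀`; `σ₀` and the measure-level identification are the landed Thm. 1.14 (13) files.  (iii) §4's
`det_jac_su2Coord` is about the Jacobian determinant only; the constant `σ₀ = 1/2π²` is r07's/pub-balaban's
(`B10Eq18SigmaSU2Haar`, `T4HaarSU2ExpChart`).  (iv) Nothing of
`B13HaarSigmaJacobian`, `B12LieComplexification`, F1–F3 is re-proved.
-/

noncomputable section

open scoped Matrix.Norms.Operator
open Module Polynomial Matrix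
open _root_.Complex (I)

namespace Literature.MathematicalPhysics.QuantumFieldTheory.Balaban1983to89.HaarDensitySpecialUnitaryExplicit

open B13HaarSigma (phi phi_zero)
open B13HaarSigmaJacobian (adg jac adg_apply_coe hlie_lieSubalgebra)
open B12LieComplexification (complexify complexify_su_eq_sl)
open HaarDensityComplexification (coe_mem_complexify det_jac_eq_prod_roots_complexify_of_le_unitaryLie)
open HaarDensityUnitaryExplicit (roots_charpoly_neg bind_sub_neg_eq isHermitian_neg_I_smul
  roots_charpoly_eq_of_skewHermitian det_jac_unitaryLie_eq_prod_roots det_jac_unitaryLie_eq_prod_phi_of_roots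
  det_jac_unitaryLie_eq_prod_sinc_of_roots det_jac_unitaryLie_eq_sq_prod_sinc_lt)
open Literature.Algebra.Lie.CompactKillingForm (unitaryLie su mem_su_iff su_le_unitaryLie)
open B10Eq18SigmaSU2 (su2Coord su2Coord_mem_su)
open Literature.LinearAlgebra.AdEigenvalues (ad_mapsTo_ker_trace prod_map_roots_charpoly_restrict_ad)

-- Mathlib idiom (as in `B12LieComplexification`, `B13HaarSigmaJacobian` §7, `CompactKillingForm`): the commutator
-- bracket on an associative ring is the NON-instance `LieRing.ofAssociativeRing`, enabled file-locally; it overrides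
-- nothing (there is no global `LieRing (Matrix n n ℂ)`), and the tree's `su`, `unitaryLie`, `complexify` are stated with it.
attribute [local instance 100] LieRing.ofAssociativeRing

variable {n : Type*} [Fintype n] [DecidableEq n]

/-! ## §1  `𝔰𝔲(N)ᶜ = 𝔰𝔩(N, ℂ)`: the characteristic polynomial of `ad` on the complexification -/

/-- `𝔰𝔲(N)ᶜ = 𝔰𝔩(N, ℂ) = ker tr` as complex subspaces of `M_N(ℂ)` (`su(n)_ℂ ≅ sl(n;ℂ)`).
[cite: Balaban1987RG1, §0 p.252, p.259] [cite: Hall2015, §3.6 (3.17)] -/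
theorem complexify_su_toSubmodule_eq :
    (complexify (su n)).toSubmodule = LinearMap.ker (Matrix.traceLinearMap n ℂ ℂ) := by
  rw [complexify_su_eq_sl]; rfl

/-- **`charpoly(ad_{𝔰𝔲(N)ᶜ} z) = charpoly(ad z|_{𝔰𝔩(N,ℂ)})`** (transport along `𝔰𝔲(N)ᶜ = ker tr`).
[cite: Rossmann2002, §3.2 (5)] [cite: Balaban1987RG1, §0 p.252] -/
theorem charpoly_adg_complexify_su_eq (z : (complexify (su n)).toSubmodule) :
    (adg (hlie_lieSubalgebra (complexify (su n))) z :
        (complexify (su n)).toSubmodule →ₗ[ℂ] (complexify (su n)).toSubmodule).charpoly =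
      ((LinearMap.mulLeft ℂ (z : Matrix n n ℂ) - LinearMap.mulRight ℂ (z : Matrix n n ℂ)).restrict
        (ad_mapsTo_ker_trace (z : Matrix n n ℂ))).charpoly := by
  let e : (complexify (su n)).toSubmodule ≃ₗ[ℂ] LinearMap.ker (Matrix.traceLinearMap n ℂ ℂ) :=
    LinearEquiv.ofEq _ _ complexify_su_toSubmodule_eq
  have hconj : e.conj (adg (hlie_lieSubalgebra (complexify (su n))) z :
      (complexify (su n)).toSubmodule →ₗ[ℂ] (complexify (su n)).toSubmodule) =
      (LinearMap.mulLeft ℂ (z : Matrix n n ℂ) - LinearMap.mulRight ℂ (z : Matrix n n ℂ)).restrict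
        (ad_mapsTo_ker_trace (z : Matrix n n ℂ)) := by
    refine LinearMap.ext fun M => Subtype.ext ?_
    rw [LinearEquiv.conj_apply, LinearMap.comp_apply, LinearMap.comp_apply, LinearEquiv.coe_coe,
      LinearEquiv.coe_coe, LinearEquiv.coe_ofEq_apply, ContinuousLinearMap.coe_coe, adg_apply_coe,
      LinearEquiv.ofEq_symm, LinearEquiv.coe_ofEq_apply, LinearMap.coe_restrict_apply, LinearMap.sub_apply,
      LinearMap.mulLeft_apply, LinearMap.mulRight_apply]
  rw [← hconj, LinearEquiv.charpoly_conj]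

/-! ## §2  `(det jac_{𝔰𝔲(N)}(X) : ℂ) = Π_{(λ,μ)} φ(λ − μ) = (det jac_{𝔲(N)}(X) : ℂ)` -/

omit [DecidableEq n] in
/-- `(card n : ℂ) ≠ 0` for non-empty `n`. [folklore] -/
private theorem card_ne_zero [Nonempty n] : (Fintype.card n : ℂ) ≠ 0 :=
  Nat.cast_ne_zero.2 Fintype.card_ne_zero

/-- **`(det jac_{𝔰𝔲(N)}(X) : ℂ) = Π φ(λ − μ)` over the ordered pairs `(λ, μ)` of characteristic roots of `X`**
(`N ≥ 1`), for every traceless skew-Hermitian `X`: `𝔰𝔲(N)ᶜ = 𝔰𝔩(N,ℂ)`, whose `ad`-eigenvalues are the `λ_j − λ_k` with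
one zero removed ([Rossmann2002] §3.2 (5), F1), and `φ(0) = 1`. [cite: Balaban1985UV3, p. 260]
[cite: Helgason2000, Ch. I §1 Thm. 1.14 (12) p. 96] [cite: Rossmann2002, §1.2 Lemma 8, §3.2 (5)] -/
theorem det_jac_su_eq_prod_roots [Nonempty n] (x : (su n).toSubmodule) :
    algebraMap ℝ ℂ (LinearMap.det (jac (hlie_lieSubalgebra (su n)) x :
        (su n).toSubmodule →ₗ[ℝ] (su n).toSubmodule)) =
      (((x : Matrix n n ℂ).charpoly.roots.bind fun lam =>
        (x : Matrix n n ℂ).charpoly.roots.map fun mu => phi (lam - mu))).prod := by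
  rw [det_jac_eq_prod_roots_complexify_of_le_unitaryLie (su n) (su_le_unitaryLie n) x,
    charpoly_adg_complexify_su_eq]
  have hneg : (((-⟨(x : Matrix n n ℂ), coe_mem_complexify (su n) x⟩ :
      (complexify (su n)).toSubmodule) : (complexify (su n)).toSubmodule) : Matrix n n ℂ) =
      -(x : Matrix n n ℂ) := rfl
  rw [hneg, prod_map_roots_charpoly_restrict_ad card_ne_zero _ phi phi_zero, roots_charpoly_neg, bind_sub_neg_eq,
    Multiset.map_bind]
  simp only [Multiset.map_map, Function.comp_def]

/-- The inclusion `𝔰𝔲(N) ⊆ 𝔲(N)` on elements. [cite: Hall2015, Example 7.3] -/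
theorem coe_mem_unitaryLie (x : (su n).toSubmodule) : (x : Matrix n n ℂ) ∈ (unitaryLie n).toSubmodule :=
  su_le_unitaryLie n x.2

/-- **`det jac_{𝔰𝔲(N)}(X) = det jac_{𝔲(N)}(X)` for `X ∈ 𝔰𝔲(N)`** (`N ≥ 1`): the Haar densities `σ/σ₀` of `SU(N)` and
`U(N)` in exponential coordinates agree on `𝔰𝔲(N)` (both are `Π_{(λ,μ)} φ(λ − μ)`; the central direction `i·1` of
`𝔲(N)` carries the eigenvalue `0`, `φ(0) = 1`). [cite: Balaban1985UV3, p. 260] [cite: Helgason2000, Ch. I §1 Thm. 1.14 (12) p. 96] -/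
theorem det_jac_su_eq_det_jac_unitaryLie [Nonempty n] (x : (su n).toSubmodule) :
    LinearMap.det (jac (hlie_lieSubalgebra (su n)) x : (su n).toSubmodule →ₗ[ℝ] (su n).toSubmodule) =
      LinearMap.det (jac (hlie_lieSubalgebra (unitaryLie n)) ⟨x, coe_mem_unitaryLie x⟩ :
        (unitaryLie n).toSubmodule →ₗ[ℝ] (unitaryLie n).toSubmodule) := by
  apply (algebraMap ℝ ℂ).injective
  rw [det_jac_su_eq_prod_roots, det_jac_unitaryLie_eq_prod_roots]

/-! ## §3  The closed forms `Π_j Π_k φ(i(θ_j − θ_k))` and `Π_j Π_k sinc((θ_j − θ_k)/2)` on `𝔰𝔲(N)` -/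

/-- **`(det jac_{𝔰𝔲(N)}(X) : ℂ) = Π_j Π_k φ(i(θ_j − θ_k))`** when the characteristic roots of `X ∈ 𝔰𝔲(N)` are the `iθ_j`.
[cite: Balaban1985UV3, p. 260] [cite: Sepanski2007, Thm. 5.14] [cite: Rossmann2002, §3.2 (5)] -/
theorem det_jac_su_eq_prod_phi_of_roots [Nonempty n] (x : (su n).toSubmodule) (θ : n → ℝ)
    (hθ : (x : Matrix n n ℂ).charpoly.roots = Finset.univ.val.map fun j => I * (θ j : ℂ)) :
    algebraMap ℝ ℂ (LinearMap.det (jac (hlie_lieSubalgebra (su n)) x :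
        (su n).toSubmodule →ₗ[ℝ] (su n).toSubmodule)) =
      ∏ j, ∏ k, phi (I * ((θ j - θ k : ℝ) : ℂ)) := by
  rw [det_jac_su_eq_det_jac_unitaryLie]
  exact det_jac_unitaryLie_eq_prod_phi_of_roots _ θ hθ

/-- **THE EXPLICIT HAAR DENSITY OF `SU(N)` IN EXPONENTIAL COORDINATES ([Balaban1985UV3] p. 260 «calculated
explicitly», print's example group): `det jac_{𝔰𝔲(N)}(X) = Π_j Π_k sinc((θ_j − θ_k)/2)`** whenever the characteristic
roots of the traceless skew-Hermitian `X` are `iθ_1, …, iθ_N` (`Σθ_j = 0`); equivalently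
`Π_{j<k} (sin((θ_j − θ_k)/2)/((θ_j − θ_k)/2))²`. [cite: Balaban1985UV3, p. 260]
[cite: Helgason2000, Ch. I §1 Thm. 1.14 (12) p. 96] [cite: Sepanski2007, Thm. 5.14] [cite: Rossmann2002, §3.2 (5)] -/
theorem det_jac_su_eq_prod_sinc_of_roots [Nonempty n] (x : (su n).toSubmodule) (θ : n → ℝ)
    (hθ : (x : Matrix n n ℂ).charpoly.roots = Finset.univ.val.map fun j => I * (θ j : ℂ)) :
    LinearMap.det (jac (hlie_lieSubalgebra (su n)) x : (su n).toSubmodule →ₗ[ℝ] (su n).toSubmodule) =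
      ∏ j, ∏ k, Real.sinc ((θ j - θ k) / 2) := by
  rw [det_jac_su_eq_det_jac_unitaryLie]
  exact det_jac_unitaryLie_eq_prod_sinc_of_roots _ θ hθ

/-- **`det jac_{𝔰𝔲(N)}(X) = Π_j Π_k sinc((θ_j − θ_k)/2)`, `θ = (−iX).eigenvalues`** (Mathlib's labelling of the
eigenvalues of the Hermitian matrix `−iX`) — print's «calculated explicitly for all classical groups» for its own
example group `G = SU(N)`, every `N ≥ 1`. [cite: Balaban1985UV3, p. 260] [cite: Helgason2000, Ch. I §1 Thm. 1.14 (12) p. 96]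
[cite: Sepanski2007, Thm. 5.14] [cite: Rossmann2002, §3.2 (5)] -/
theorem det_jac_su_eq_prod_sinc [Nonempty n] (x : (su n).toSubmodule) :
    LinearMap.det (jac (hlie_lieSubalgebra (su n)) x : (su n).toSubmodule →ₗ[ℝ] (su n).toSubmodule) =
      ∏ j, ∏ k, Real.sinc (((isHermitian_neg_I_smul (mem_su_iff.1 x.2).1).eigenvalues j -
        (isHermitian_neg_I_smul (mem_su_iff.1 x.2).1).eigenvalues k) / 2) :=
  det_jac_su_eq_prod_sinc_of_roots x _ (roots_charpoly_eq_of_skewHermitian (mem_su_iff.1 x.2).1)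

/-- **`det jac_{𝔰𝔲(N)}(X) = Π_{j<k} (sin((θ_j − θ_k)/2)/((θ_j − θ_k)/2))²`** (squared form, any linear order on the
indices). [cite: Balaban1985UV3, p. 260] [cite: Helgason2000, Ch. I §1 Thm. 1.14 (12) p. 96] [cite: Sepanski2007, Thm. 5.14] -/
theorem det_jac_su_eq_sq_prod_sinc_lt [Nonempty n] [LinearOrder n] (x : (su n).toSubmodule) (θ : n → ℝ)
    (hθ : (x : Matrix n n ℂ).charpoly.roots = Finset.univ.val.map fun j => I * (θ j : ℂ)) :
    LinearMap.det (jac (hlie_lieSubalgebra (su n)) x : (su n).toSubmodule →ₗ[ℝ] (su n).toSubmodule) =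
      (∏ p ∈ (Finset.univ : Finset (n × n)).filter (fun p => p.1 < p.2), Real.sinc ((θ p.1 - θ p.2) / 2)) ^ 2 := by
  rw [det_jac_su_eq_det_jac_unitaryLie]
  exact det_jac_unitaryLie_eq_sq_prod_sinc_lt _ θ hθ

/-! ## §4  Print's example `SU(2)`: characteristic roots `±ir` give `σ(A)/σ₀ = (sin r / r)²` -/

/-- **`SU(2)`: if the characteristic roots of `X ∈ 𝔰𝔲(2)` are `ir, −ir` then `det jac_{𝔰𝔲(2)}(X) = sinc(r)²`** — for
`X = iΣσ_aA^a` (`r = |A|`) this is print's `σ(A)/σ₀ = (sin|A|/|A|)²`, the value of r10's `det_jac_su2` / r07's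
`sigmaRel_su2`, now as the `N = 2` case of the general `Π_{j,k} sinc((θ_j − θ_k)/2)`. [cite: Balaban1985UV3, p. 260] -/
theorem det_jac_su_two_eq_sinc_sq (x : (su (Fin 2)).toSubmodule) (r : ℝ)
    (hθ : (x : Matrix (Fin 2) (Fin 2) ℂ).charpoly.roots = {I * (r : ℂ), I * ((-r : ℝ) : ℂ)}) :
    LinearMap.det (jac (hlie_lieSubalgebra (su (Fin 2))) x :
        (su (Fin 2)).toSubmodule →ₗ[ℝ] (su (Fin 2)).toSubmodule) = Real.sinc r ^ 2 := by
  have h := det_jac_su_eq_prod_sinc_of_roots x ![r, -r] (by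
    rw [hθ]
    simp only [Fin.univ_val_map, List.ofFn_succ, List.ofFn_zero, Matrix.cons_val_zero, Matrix.cons_val_succ,
      Complex.ofReal_neg, mul_neg, Multiset.insert_eq_cons]
    rfl)
  rw [h, Fin.prod_univ_two, Fin.prod_univ_two, Fin.prod_univ_two]
  simp only [Matrix.cons_val_zero, Matrix.cons_val_one]
  rw [show (r - -r) / 2 = r by ring, show (-r - r) / 2 = -r by ring, Real.sinc_neg, sub_self, sub_self, zero_div,
    Real.sinc_zero, one_mul, mul_one, sq]

/-- The printed value: `sinc(r)² = (sin r / r)²` for `r ≠ 0`. [cite: Balaban1985UV3, p. 260] -/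
theorem sinc_sq_eq (r : ℝ) (hr : r ≠ 0) : Real.sinc r ^ 2 = (Real.sin r / r) ^ 2 := by
  rw [Real.sinc_of_ne_zero hr]

/-- In print's Pauli coordinates `X(A) = iΣ_a σ_aA^a` (r07's `B10Eq18SigmaSU2.su2Coord`): `charpoly X(A) = T² + |A|²`,
`|A|² = Σ_a (A^a)²`. [cite: Balaban1985UV3, p. 260] -/
theorem charpoly_su2Coord (A : Fin 3 → ℝ) :
    (su2Coord A).charpoly = X ^ 2 + C (((dotProduct A A : ℝ) : ℂ)) := by
  rw [Matrix.charpoly_fin_two]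
  have ht : (su2Coord A).trace = 0 := by simp [su2Coord, Matrix.trace_fin_two]
  have hd : (su2Coord A).det = ((dotProduct A A : ℝ) : ℂ) := by
    simp only [su2Coord, Matrix.det_fin_two_of, dotProduct, Fin.sum_univ_three]
    push_cast; ring_nf; rw [Complex.I_sq]; ring
  rw [ht, hd, map_zero, zero_mul, sub_zero]

/-- **The characteristic roots of `X(A) = iΣ_a σ_aA^a` are `±i|A|`**, `|A| = √(Σ(A^a)²)` (print's «|A| = Σ_{a=1}^{3}
(A^a)²» [sic]). [cite: Balaban1985UV3, p. 260] -/
theorem roots_charpoly_su2Coord (A : Fin 3 → ℝ) :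
    (su2Coord A).charpoly.roots =
      {I * (Real.sqrt (dotProduct A A) : ℂ), I * ((-Real.sqrt (dotProduct A A) : ℝ) : ℂ)} := by
  set r := Real.sqrt (dotProduct A A) with hr
  have hr2 : ((dotProduct A A : ℝ) : ℂ) = (r : ℂ) ^ 2 := by
    rw [← Complex.ofReal_pow, Real.sq_sqrt]
    exact Finset.sum_nonneg fun i _ => mul_self_nonneg (A i)
  set a : ℂ := I * (r : ℂ) with ha
  have hna : I * ((-r : ℝ) : ℂ) = -a := by rw [ha]; push_cast; ring
  have hc : (su2Coord A).charpoly = (X - C a) * (X - C (-a)) := by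
    rw [charpoly_su2Coord, hr2, map_neg]
    have : C ((r : ℂ) ^ 2) = -(C a * C a) := by
      rw [← map_mul, ← map_neg, ha]; congr 1; ring_nf; rw [Complex.I_sq]; ring
    rw [this]; ring
  rw [hna, hc, Polynomial.roots_mul (mul_ne_zero (Polynomial.X_sub_C_ne_zero _) (Polynomial.X_sub_C_ne_zero _)),
    Polynomial.roots_X_sub_C, Polynomial.roots_X_sub_C]
  rfl

/-- **PRINT'S EXAMPLE, HYPOTHESIS-FREE: `det jac_{𝔰𝔲(2)}(iΣ_a σ_aA^a) = sinc(|A|)² = (sin|A|/|A|)²`** (`|A| ≠ 0`; `= 1` at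
`A = 0`), `|A| = √(Σ(A^a)²)` — [Balaban1985UV3] p. 260 «for SU(2) we have σ(A) = 1/2π² (sin|A|/|A|)²» up to `σ₀ = 1/2π²`,
obtained here as the `N = 2` case of `Π_{j,k} sinc((θ_j − θ_k)/2)`; the same Jacobian determinant as r10's
`B13HaarSigmaJacobian.det_jac_su2` (Pauli-coordinate `ad`-matrix route) and r07's `B10Eq18SigmaSU2.sigmaRel_su2`.
[cite: Balaban1985UV3, p. 260] [cite: Helgason2000, Ch. I §1 Thm. 1.14 (12) p. 96] -/
theorem det_jac_su2Coord (A : Fin 3 → ℝ) :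
    LinearMap.det (jac (hlie_lieSubalgebra (su (Fin 2))) ⟨su2Coord A, su2Coord_mem_su A⟩ :
        (su (Fin 2)).toSubmodule →ₗ[ℝ] (su (Fin 2)).toSubmodule) = Real.sinc (Real.sqrt (dotProduct A A)) ^ 2 :=
  det_jac_su_two_eq_sinc_sq _ _ (roots_charpoly_su2Coord A)

end Literature.MathematicalPhysics.QuantumFieldTheory.Balaban1983to89.HaarDensitySpecialUnitaryExplicit
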